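import Mathlib
import Literature.MathematicalPhysics.QuantumFieldTheory.Balaban1983to89.BlockAveragingExpMeanLogContinuous
import Literature.MathematicalPhysics.QuantumFieldTheory.Balaban1983to89.T3ThresholdRemoval
import Literature.MathematicalPhysics.QuantumFieldTheory.Balaban1983to89.T3UnitLawDensityEML

/-!
# Toward `GuardedTransfer` (route GuardedThresholdRemoval, crux r3, stmt-QuantumFields-28026), part 1 of 2:
# a CONTINUOUS small-loop average agreeing with the printed `exp[mean log]` off an `η`-collar of its guard

The crux `GuardedTransfer` transfers the continuum limit from the once-refined family `(F.refine 1, γL⁻¹)` to `(F, γ)` at the PRINTED,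
DISCONTINUOUS small-field averaging `ℰp = expMeanLogSU`, given that the refined unit laws put vanishing mass near the guard spheres
`dist₁(W_{c,i}) = δ` of the one-step (0.4) loops.  The tree's `T3ThresholdRemoval` proves the transfer only at the CONTINUOUS profile
`expMeanLogSUc` (flags THR / D2-CONT), because Lévy's density argument needs the original strings to be continuous functions of the refined
unit field.  The device of this line: for every collar width `η > 0`, modify `ℰp` CONTINUOUSLY inside the collar only.

* §1 `exists_collar_loopAverage`: for every `η > 0` there is `ℰ_η : LoopAverage SU(N)` with the radius `δ_N` of `expMeanLogSU`, whose
  operation is continuous at every arity, equals the printed operation on families with all `dist₁(W_i) ≤ δ_N − η`, and equals `1` off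
  the guard — the construction of the tree's `ExpMeanLog.expMeanLogSUc` ([Balaban1987RG1] (0.4)–(0.7) p. 253: «valid universally for
  all averages satisfying the above properties») with the piecewise-linear cutoff moved into `[δ_N − η, δ_N − η/2]`; (0.5)–(0.7) hold on
  the whole guard because the scaled exponent `χ · meanLog` inherits them from `log` (tree `emlc_inv_mul`, `emlc_conj`, `emlc_comp_equiv`).
* §2 For ANY small-loop average with a continuous operation equal to `1` off its guard: the guarded correction factor of (0.4) has no
  jump, the total block averaging is continuous at every level, its iterates are continuous, the operation is measurable, and the
  original string `coarseObs F k ℰ' Cs` is a continuous function of the refined unit field (the tree's `continuous_avgFun_expMeanLogSUc`,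
  `continuous_iter_blockAvg_expMeanLogSUc`, `continuous_coarseObs`, abstracted from `expMeanLogSUc`).

Part 2 (`Theorems/GuardedThresholdRemovalGuardedTransfer.lean`) adds the agreement off the collar, Lévy + ε/3 at `ℰp`, and the theorem.
HONEST FRAMING: kernel bookkeeping about block-averaging profiles; nothing here is an estimate, and nothing bears on the YM mass gap
(route GuardedThresholdRemoval closes the RECORD rung R3 only, given its other cruxes).
-/

noncomputable section

open MeasureTheory Filter Topology NormedSpace
open scoped BigOperators Matrix.Norms.L2Operator
open Literature.MathematicalPhysics.QuantumFieldTheory.Balaban1983to89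
open Literature.MathematicalPhysics.QuantumFieldTheory.Balaban1983to89.ExpMeanLog
open Literature.MathematicalPhysics.QuantumFieldTheory.Balaban1983to89.MatrixLog (mlog)
open Literature.MathematicalPhysics.QuantumFieldTheory.Balaban1983to89.T3ContinuumYM3Torus
open Literature.MathematicalPhysics.QuantumFieldTheory.Balaban1983to89.T3LevelShift
open Literature.MathematicalPhysics.QuantumFieldTheory.Balaban1983to89.T3ThresholdRemoval
open Literature.MathematicalPhysics.QuantumFieldTheory.Balaban1983to89.T3UnitLawDensityEML
open Literature.MathematicalPhysics.QuantumFieldTheory.Balaban1983to89.Missing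
open Literature.MathematicalPhysics.QuantumFieldTheory.Balaban1983to89.T4Continuum

namespace Summit.QuantumFields.YangMills.Theorems.GuardedTransfer

/-! ## §1 A continuous small-loop average agreeing with the printed one off an `η`-collar of the guard -/

section Collar

variable {n : Type} [Fintype n] [DecidableEq n] [Nonempty n] {ι : Type*} [Fintype ι]

/-- The collar profile `ψ(t) = max(0, min(1, (2(δ−t) − η)/η))` equals `1` for `t ≤ δ − η` (`η > 0`). [folklore] -/
private theorem collarProfile_eq_one {δ η t : ℝ} (hη : 0 < η) (ht : t ≤ δ - η) :
    max 0 (min 1 ((2 * (δ - t) - η) / η)) = 1 := by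
  have h : 1 ≤ (2 * (δ - t) - η) / η := by rw [le_div_iff₀ hη]; linarith
  rw [min_eq_left h, max_eq_right zero_le_one]

/-- The collar profile equals `0` for `t ≥ δ − η/2` (`η > 0`). [folklore] -/
private theorem collarProfile_eq_zero {δ η t : ℝ} (hη : 0 < η) (ht : δ - η / 2 ≤ t) :
    max 0 (min 1 ((2 * (δ - t) - η) / η)) = 0 := by
  have h : (2 * (δ - t) - η) / η ≤ 0 := div_nonpos_of_nonpos_of_nonneg (by linarith) hη.le
  rw [max_eq_left]
  exact (min_le_right _ _).trans h

/-- The collar profile is continuous. [folklore] -/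
private theorem continuous_collarProfile (δ η : ℝ) : Continuous fun t : ℝ => max 0 (min 1 ((2 * (δ - t) - η) / η)) := by
  fun_prop

omit [Nonempty n] in
/-- The collar cutoff `χ_η(W) = ∏_i ψ(‖W_i − 1‖)` is `1` when all `‖W_i − 1‖ ≤ δ_N − η`. [folklore] -/
private theorem collarCutoff_eq_one {η : ℝ} (hη : 0 < η) {W : ι → Matrix.specialUnitaryGroup n ℂ}
    (h : ∀ i, ‖(W i : Matrix n n ℂ) - 1‖ ≤ deltaSU n - η) :
    (∏ i, max 0 (min 1 ((2 * (deltaSU n - ‖(W i : Matrix n n ℂ) - 1‖) - η) / η))) = 1 :=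
  Finset.prod_eq_one fun i _ => collarProfile_eq_one hη (h i)

omit [Nonempty n] in
/-- The collar cutoff is `0` as soon as some `‖W_i − 1‖ ≥ δ_N − η/2`. [folklore] -/
private theorem collarCutoff_eq_zero {η : ℝ} (hη : 0 < η) {W : ι → Matrix.specialUnitaryGroup n ℂ} {i : ι}
    (h : deltaSU n - η / 2 ≤ ‖(W i : Matrix n n ℂ) - 1‖) :
    (∏ i, max 0 (min 1 ((2 * (deltaSU n - ‖(W i : Matrix n n ℂ) - 1‖) - η) / η))) = 0 :=
  Finset.prod_eq_zero (Finset.mem_univ i) (collarProfile_eq_zero hη h)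

omit [Nonempty n] in
/-- If the collar cutoff is non-zero the family is inside the guard `∀ i, ‖W_i − 1‖ < δ_N` (indeed `< δ_N − η/2`). [folklore] -/
private theorem small_of_collarCutoff_ne_zero {η : ℝ} (hη : 0 < η) {W : ι → Matrix.specialUnitaryGroup n ℂ}
    (h : (∏ i, max 0 (min 1 ((2 * (deltaSU n - ‖(W i : Matrix n n ℂ) - 1‖) - η) / η))) ≠ 0) (i : ι) :
    ‖(W i : Matrix n n ℂ) - 1‖ < deltaSU n := by
  by_contra hle
  exact h (collarCutoff_eq_zero hη ((by linarith : deltaSU n - η / 2 ≤ deltaSU n).trans (not_lt.mp hle)))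

omit [Nonempty n] in
/-- The collar cutoff is invariant under pointwise inversion. [folklore] -/
private theorem collarCutoff_inv (η : ℝ) (W : ι → Matrix.specialUnitaryGroup n ℂ) :
    (∏ i, max 0 (min 1 ((2 * (deltaSU n - ‖(((W i)⁻¹ : Matrix.specialUnitaryGroup n ℂ) : Matrix n n ℂ) - 1‖) - η) / η))) =
      ∏ i, max 0 (min 1 ((2 * (deltaSU n - ‖(W i : Matrix n n ℂ) - 1‖) - η) / η)) := by
  refine Finset.prod_congr rfl fun i _ => ?_
  show max 0 (min 1 ((2 * (deltaSU n - ‖star (W i : Matrix n n ℂ) - 1‖) - η) / η)) = _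
  rw [norm_star_sub_one]

omit [Nonempty n] in
/-- The collar cutoff is invariant under simultaneous conjugation. [folklore] -/
private theorem collarCutoff_conj (η : ℝ) (W : ι → Matrix.specialUnitaryGroup n ℂ) (u : Matrix.specialUnitaryGroup n ℂ) :
    (∏ i, max 0 (min 1 ((2 * (deltaSU n - ‖((u * W i * u⁻¹ : Matrix.specialUnitaryGroup n ℂ) : Matrix n n ℂ) - 1‖) - η) / η))) =
      ∏ i, max 0 (min 1 ((2 * (deltaSU n - ‖(W i : Matrix n n ℂ) - 1‖) - η) / η)) := by
  have hu : (u : Matrix n n ℂ) ∈ Matrix.unitaryGroup n ℂ := (Matrix.mem_specialUnitaryGroup_iff.1 u.2).1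
  have hu' : ((u⁻¹ : Matrix.specialUnitaryGroup n ℂ) : Matrix n n ℂ) ∈ Matrix.unitaryGroup n ℂ :=
    (Matrix.mem_specialUnitaryGroup_iff.1 (u⁻¹).2).1
  have hvw : (u : Matrix n n ℂ) * ((u⁻¹ : Matrix.specialUnitaryGroup n ℂ) : Matrix n n ℂ) = 1 :=
    Unitary.mul_star_self_of_mem hu
  refine Finset.prod_congr rfl fun i _ => ?_
  show max 0 (min 1 ((2 * (deltaSU n -
      ‖(u : Matrix n n ℂ) * (W i : Matrix n n ℂ) * ((u⁻¹ : Matrix.specialUnitaryGroup n ℂ) : Matrix n n ℂ) - 1‖) - η) / η)) = _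
  rw [norm_conj_sub_one_eq hu hu' hvw]

omit [Nonempty n] in
/-- The collar cutoff is invariant under reindexing. [folklore] -/
private theorem collarCutoff_comp_equiv (η : ℝ) (W : ι → Matrix.specialUnitaryGroup n ℂ) (σ : Equiv.Perm ι) :
    (∏ i, max 0 (min 1 ((2 * (deltaSU n - ‖((W ∘ σ) i : Matrix n n ℂ) - 1‖) - η) / η))) =
      ∏ i, max 0 (min 1 ((2 * (deltaSU n - ‖(W i : Matrix n n ℂ) - 1‖) - η) / η)) :=
  Fintype.prod_equiv σ _ _ fun _ => rfl

omit [Nonempty n] in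
/-- The collar cutoff is continuous. [folklore] -/
private theorem continuous_collarCutoff (η : ℝ) :
    Continuous fun W : ι → Matrix.specialUnitaryGroup n ℂ =>
      ∏ i, max 0 (min 1 ((2 * (deltaSU n - ‖(W i : Matrix n n ℂ) - 1‖) - η) / η)) := by
  refine continuous_finsetProd _ fun i _ => (continuous_collarProfile (deltaSU n) η).comp ?_
  exact ((continuous_subtype_val.comp (continuous_apply i)).sub continuous_const).norm

/-- The scaled printed operation with the collar cutoff as scale is `SU(N)`-valued. [cite: Balaban1987RG1, (0.9) p.253] -/
private theorem emlc_collar_mem {η : ℝ} (hη : 0 < η) (W : ι → Matrix.specialUnitaryGroup n ℂ) :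
    emlc (∏ i, max 0 (min 1 ((2 * (deltaSU n - ‖(W i : Matrix n n ℂ) - 1‖) - η) / η))) (fun i => (W i : Matrix n n ℂ)) ∈
      Matrix.specialUnitaryGroup n ℂ := by
  by_cases h : (∏ i, max 0 (min 1 ((2 * (deltaSU n - ‖(W i : Matrix n n ℂ) - 1‖) - η) / η))) = 0
  · rw [h, emlc_zero]; exact Submonoid.one_mem _
  · exact emlc_mem_specialUnitaryGroup _ (fun i => (W i).2) (small_of_collarCutoff_ne_zero hη h)

omit [Nonempty n] in
/-- The mean logarithm is continuous at every family of matrices with all `‖W_i − 1‖ < 1` (the series logarithm is analytic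
there; as in the tree's `BlockAveragingExpMeanLogContinuous`). [folklore] -/
private theorem continuousAt_meanLog' {W : ι → Matrix n n ℂ} (hW : ∀ i, ‖W i - 1‖ < 1) :
    ContinuousAt (meanLog : (ι → Matrix n n ℂ) → Matrix n n ℂ) W := by
  have hsum : ContinuousAt (fun W : ι → Matrix n n ℂ => ∑ i, mlog (W i)) W :=
    tendsto_finsetSum _ fun i _ =>
      ContinuousAt.comp (f := fun W : ι → Matrix n n ℂ => W i) (AnalyticAt.continuousAt (analyticAt_mlog (hW i)))
        (continuous_apply (A := fun _ : ι => Matrix n n ℂ) i).continuousAt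
  unfold meanLog
  exact (continuousAt_const (y := ((Fintype.card ι : ℂ))⁻¹)).smul hsum

/-- The matrix-valued map `W ↦ exp[χ_η(W) · meanLog W]` is continuous on `SU(N)`-families. [cite: Balaban1987RG1, (0.4) p.253] -/
private theorem continuous_emlc_collar {η : ℝ} (hη : 0 < η) :
    Continuous fun W : ι → Matrix.specialUnitaryGroup n ℂ =>
      emlc (∏ i, max 0 (min 1 ((2 * (deltaSU n - ‖(W i : Matrix n n ℂ) - 1‖) - η) / η))) (fun i => (W i : Matrix n n ℂ)) := by
  letI : NormedAlgebra ℚ (Matrix n n ℂ) := NormedAlgebra.restrictScalars ℚ ℂ _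
  have hcoe : Continuous fun W : ι → Matrix.specialUnitaryGroup n ℂ => fun i => (W i : Matrix n n ℂ) :=
    continuous_pi fun i => continuous_subtype_val.comp (continuous_apply i)
  -- the exponent `χ_η(W) • meanLog W` is continuous
  suffices hexp : Continuous fun W : ι → Matrix.specialUnitaryGroup n ℂ =>
      (((∏ i, max 0 (min 1 ((2 * (deltaSU n - ‖(W i : Matrix n n ℂ) - 1‖) - η) / η)) : ℝ) : ℂ)) •
        meanLog fun i => (W i : Matrix n n ℂ) by
    exact exp_continuous.comp hexp
  refine continuous_iff_continuousAt.2 fun W => ?_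
  by_cases h : ∀ i, ‖(W i : Matrix n n ℂ) - 1‖ < 1
  · -- inside the unit guard: both factors are continuous at `W`
    have h2 : ContinuousAt (fun W' : ι → Matrix.specialUnitaryGroup n ℂ => meanLog fun i => (W' i : Matrix n n ℂ)) W :=
      ContinuousAt.comp (f := fun W' : ι → Matrix.specialUnitaryGroup n ℂ => fun i => (W' i : Matrix n n ℂ))
        (continuousAt_meanLog' h) hcoe.continuousAt
    exact ((Complex.continuous_ofReal.comp (continuous_collarCutoff η)).continuousAt).smul h2
  · -- some `‖W_i − 1‖ ≥ 1 > δ_N − η/2`: the cutoff vanishes on a neighbourhood of `W`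
    obtain ⟨i, hi⟩ := not_forall.mp h
    have hi : 1 ≤ ‖(W i : Matrix n n ℂ) - 1‖ := not_lt.mp hi
    have hδ : deltaSU n - η / 2 < 1 := by
      have := lt_third_of_lt_deltaSU (n := n) (t := deltaSU n / 2) (by linarith [deltaSU_pos (n := n)])
      linarith
    have hopen : IsOpen {W' : ι → Matrix.specialUnitaryGroup n ℂ | deltaSU n - η / 2 < ‖(W' i : Matrix n n ℂ) - 1‖} :=
      isOpen_lt continuous_const ((continuous_subtype_val.comp (continuous_apply i)).sub continuous_const).norm
    have hmem : W ∈ {W' : ι → Matrix.specialUnitaryGroup n ℂ | deltaSU n - η / 2 < ‖(W' i : Matrix n n ℂ) - 1‖} :=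
      hδ.trans_le hi
    have hev : (fun W' : ι → Matrix.specialUnitaryGroup n ℂ =>
        (((∏ i, max 0 (min 1 ((2 * (deltaSU n - ‖(W' i : Matrix n n ℂ) - 1‖) - η) / η)) : ℝ) : ℂ)) •
          meanLog fun i => (W' i : Matrix n n ℂ)) =ᶠ[𝓝 W] fun _ => 0 :=
      Filter.eventually_of_mem (hopen.mem_nhds hmem) fun W' hW' => by
        simp only [Set.mem_setOf_eq] at hW'
        show (((∏ i, max 0 (min 1 ((2 * (deltaSU n - ‖(W' i : Matrix n n ℂ) - 1‖) - η) / η)) : ℝ) : ℂ)) •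
          meanLog (fun i => (W' i : Matrix n n ℂ)) = 0
        rw [collarCutoff_eq_zero hη hW'.le, Complex.ofReal_zero, zero_smul]
    exact (continuousAt_congr hev).2 continuousAt_const

/-- **A CONTINUOUS SMALL-LOOP AVERAGE AGREEING WITH THE PRINTED ONE OFF AN `η`-COLLAR OF THE GUARD.**  For every `η > 0` there is
`ℰ_η : LoopAverage SU(N)` with the radius `δ_N` of `expMeanLogSU`, whose operation is CONTINUOUS at every arity, equals the printed
`exp[i Σ |I|⁻¹ (1/i) log W_i]` (= `expMeanLogSU.E`) on families with all `dist₁(W_i) ≤ δ_N − η`, and equals `1` off the guard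
`∀ i, dist₁(W_i) < δ_N` — the tree's `expMeanLogSUc` with its cutoff moved into the collar; the axioms (0.5)–(0.7) hold on the whole
guard because the scaled exponent inherits them from `log`. [cite: Balaban1987RG1, (0.4)-(0.7) p.253] -/
theorem exists_collar_loopAverage {η : ℝ} (hη : 0 < η) :
    ∃ ℰ' : LoopAverage (Matrix.specialUnitaryGroup n ℂ),
      ℰ'.δ = (expMeanLogSU (n := n)).δ ∧
      (∀ m : ℕ, Continuous fun W : Fin (m + 1) → Matrix.specialUnitaryGroup n ℂ => ℰ'.E W) ∧
      (∀ (m : ℕ) (W : Fin (m + 1) → Matrix.specialUnitaryGroup n ℂ),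
        (∀ i, dist1 (W i) ≤ (expMeanLogSU (n := n)).δ - η) → ℰ'.E W = (expMeanLogSU (n := n)).E W) ∧
      (∀ (m : ℕ) (W : Fin (m + 1) → Matrix.specialUnitaryGroup n ℂ),
        (¬ ∀ i, dist1 (W i) < ℰ'.δ) → ℰ'.E W = 1) := by
  -- the operation, `SU(N)`-valued
  let E' : ∀ {m : ℕ}, (Fin (m + 1) → Matrix.specialUnitaryGroup n ℂ) → Matrix.specialUnitaryGroup n ℂ := fun W =>
    ⟨emlc (∏ i, max 0 (min 1 ((2 * (deltaSU n - ‖(W i : Matrix n n ℂ) - 1‖) - η) / η))) (fun i => (W i : Matrix n n ℂ)),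
      emlc_collar_mem hη W⟩
  have hE' : ∀ {m : ℕ} (W : Fin (m + 1) → Matrix.specialUnitaryGroup n ℂ), ((E' W : Matrix.specialUnitaryGroup n ℂ) : Matrix n n ℂ) =
      emlc (∏ i, max 0 (min 1 ((2 * (deltaSU n - ‖(W i : Matrix n n ℂ) - 1‖) - η) / η))) (fun i => (W i : Matrix n n ℂ)) :=
    fun W => rfl
  -- (0.7)
  have hperm : ∀ {m : ℕ} (W : Fin (m + 1) → Matrix.specialUnitaryGroup n ℂ) (σ : Equiv.Perm (Fin (m + 1))), E' (W ∘ σ) = E' W := by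
    intro m W σ
    apply Subtype.ext
    rw [hE', hE', collarCutoff_comp_equiv]
    exact emlc_comp_equiv _ (fun i => (W i : Matrix n n ℂ)) σ
  -- (0.5) on the guard
  have hinv : ∀ {m : ℕ} (W : Fin (m + 1) → Matrix.specialUnitaryGroup n ℂ), (∀ i, ‖(W i : Matrix n n ℂ) - 1‖ < deltaSU n) →
      E' (fun i => (W i)⁻¹) = (E' W)⁻¹ := by
    intro m W h
    apply eq_inv_of_mul_eq_one_left
    apply Subtype.ext
    show ((E' fun i => (W i)⁻¹) : Matrix n n ℂ) * (E' W : Matrix n n ℂ) = 1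
    rw [hE', hE', collarCutoff_inv]
    exact emlc_inv_mul _ (fun i => Unitary.mul_star_self_of_mem (Matrix.mem_specialUnitaryGroup_iff.1 (W i).2).1)
      fun i => (lt_third_of_lt_deltaSU (h i)).le
  -- (0.6), conjugations (all families)
  have hconj : ∀ {m : ℕ} (W : Fin (m + 1) → Matrix.specialUnitaryGroup n ℂ) (u : Matrix.specialUnitaryGroup n ℂ),
      E' (fun i => u * W i * u⁻¹) = u * E' W * u⁻¹ := by
    intro m W u
    have hu : (u : Matrix n n ℂ) ∈ Matrix.unitaryGroup n ℂ := (Matrix.mem_specialUnitaryGroup_iff.1 u.2).1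
    have hvw : (u : Matrix n n ℂ) * ((u⁻¹ : Matrix.specialUnitaryGroup n ℂ) : Matrix n n ℂ) = 1 :=
      Unitary.mul_star_self_of_mem hu
    have hwv : ((u⁻¹ : Matrix.specialUnitaryGroup n ℂ) : Matrix n n ℂ) * (u : Matrix n n ℂ) = 1 :=
      Unitary.star_mul_self_of_mem hu
    apply Subtype.ext
    show ((E' fun i => u * W i * u⁻¹) : Matrix n n ℂ) =
      (u : Matrix n n ℂ) * (E' W : Matrix n n ℂ) * ((u⁻¹ : Matrix.specialUnitaryGroup n ℂ) : Matrix n n ℂ)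
    rw [hE', hE', collarCutoff_conj]
    exact emlc_conj _ hvw hwv fun i => (W i : Matrix n n ℂ)
  refine ⟨LoopAverage.mk (deltaSU n) deltaSU_pos (fun W => E' W) (fun W hW => hinv W hW) (fun W _ u => hconj W u)
    (fun W _ σ => hperm W σ), rfl, fun m => ?_, fun m W hW => ?_, fun m W hW => ?_⟩
  · -- continuity at arity `m`
    exact Topology.IsInducing.subtypeVal.continuous_iff.2 (continuous_emlc_collar (ι := Fin (m + 1)) hη)
  · -- agreement with the printed operation when all `‖W_i − 1‖ ≤ δ_N − η`
    have hW' : ∀ i, ‖(W i : Matrix n n ℂ) - 1‖ ≤ deltaSU n - η := hW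
    have hWs : ∀ i, ‖(W i : Matrix n n ℂ) - 1‖ < deltaSU n := fun i => (hW' i).trans_lt (by linarith)
    apply Subtype.ext
    show ((E' W : Matrix.specialUnitaryGroup n ℂ) : Matrix n n ℂ) = ((ESU W : Matrix.specialUnitaryGroup n ℂ) : Matrix n n ℂ)
    rw [hE', collarCutoff_eq_one hη hW', emlc_one, coe_ESU_of_small hWs]
  · -- the value `1` off the guard
    have hW' : ¬ ∀ i, ‖(W i : Matrix n n ℂ) - 1‖ < deltaSU n := hW
    obtain ⟨i, hi⟩ := not_forall.mp hW'
    apply Subtype.ext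
    show ((E' W : Matrix.specialUnitaryGroup n ℂ) : Matrix n n ℂ) = ((1 : Matrix.specialUnitaryGroup n ℂ) : Matrix n n ℂ)
    rw [hE', collarCutoff_eq_zero hη ((by linarith : deltaSU n - η / 2 ≤ deltaSU n).trans (not_lt.mp hi)), emlc_zero]
    rfl

end Collar

/-! ## §2 Block averaging by a continuous no-jump small-loop average is continuous -/

section NoJump

variable {n : Type} [Fintype n] [DecidableEq n] [Nonempty n]
variable (ℰ' : LoopAverage (Matrix.specialUnitaryGroup n ℂ))

/-- For a small-loop average whose operation is `1` off its guard, the guarded correction factor of (0.4) has NO JUMP: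
`corr U c = E(loop variables)` for every configuration (the tree's `corr_expMeanLogSUc_eq`, abstracted). [cite: Balaban1987RG1, (0.4) p.253] -/
theorem corr_eq_avg_of_offGuard
    (h1 : ∀ (m : ℕ) (W : Fin (m + 1) → Matrix.specialUnitaryGroup n ℂ), (¬ ∀ i, dist1 (W i) < ℰ'.δ) → ℰ'.E W = 1)
    {P : Params} {j : ℕ} (U : GaugeField P j (Matrix.specialUnitaryGroup n ℂ)) (c : PBond P (j + 1)) :
    BlockAveraging.corr ℰ' U c = ℰ'.avg (BlockAveraging.loopHol U c) := by
  unfold BlockAveraging.corr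
  split_ifs with h
  · rfl
  · symm
    unfold LoopAverage.avg
    exact h1 _ _ fun h' => h fun i => by
      have := h' (LoopAverage.enum (BlockAveraging.Idx P) i)
      simpa using this

/-- **The total block averaging (0.4) driven by a CONTINUOUS no-jump small-loop average is continuous** in the configuration
(every lattice, every level; the tree's `continuous_avgFun_expMeanLogSUc`, abstracted). [cite: Balaban1987RG1, (0.4) p.253] -/
theorem continuous_avgFun_of
    (h1 : ∀ (m : ℕ) (W : Fin (m + 1) → Matrix.specialUnitaryGroup n ℂ), (¬ ∀ i, dist1 (W i) < ℰ'.δ) → ℰ'.E W = 1)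
    (hc : ∀ m : ℕ, Continuous fun W : Fin (m + 1) → Matrix.specialUnitaryGroup n ℂ => ℰ'.E W) {P : Params} {j : ℕ} :
    Continuous (BlockAveraging.avgFun ℰ' :
      GaugeField P j (Matrix.specialUnitaryGroup n ℂ) → GaugeField P (j + 1) (Matrix.specialUnitaryGroup n ℂ)) := by
  refine continuous_pi fun c => ?_
  have hcorr : Continuous fun U : GaugeField P j (Matrix.specialUnitaryGroup n ℂ) => BlockAveraging.corr ℰ' U c := by
    simp only [corr_eq_avg_of_offGuard ℰ' h1]
    unfold LoopAverage.avg
    exact (hc _).comp ((continuous_pi fun k => (continuous_apply _).comp (BlockAveraging.continuous_loopHol c)))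
  show Continuous fun U : GaugeField P j (Matrix.specialUnitaryGroup n ℂ) =>
    BlockAveraging.corr ℰ' U c * AveragingRT.axialAvg U c
  exact hcorr.mul ((continuous_apply c).comp BlockAveraging.continuous_axialAvg)

/-- Iterated block averaging driven by a continuous no-jump small-loop average is continuous. [cite: Balaban1987RG1, (0.11) p.253] -/
theorem continuous_iter_blockAvg_of
    (h1 : ∀ (m : ℕ) (W : Fin (m + 1) → Matrix.specialUnitaryGroup n ℂ), (¬ ∀ i, dist1 (W i) < ℰ'.δ) → ℰ'.E W = 1)
    (hc : ∀ m : ℕ, Continuous fun W : Fin (m + 1) → Matrix.specialUnitaryGroup n ℂ => ℰ'.E W) {P : Params} (k : ℕ) :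
    Continuous (Averaging.iter (fun j => BlockAveraging.blockAvg (P := P) (j := j) ℰ') k) := by
  induction k with
  | zero => exact continuous_id
  | succ k ih => exact (continuous_avgFun_of ℰ' h1 hc (j := k)).comp ih

/-- A small-loop average with a continuous operation is measurable (Borel). [folklore] -/
theorem measurableE_of_continuous
    (hc : ∀ m : ℕ, Continuous fun W : Fin (m + 1) → Matrix.specialUnitaryGroup n ℂ => ℰ'.E W) : ℰ'.MeasurableE := by
  intro m
  haveI : SecondCountableTopology (Matrix n n ℂ) := inferInstanceAs (SecondCountableTopology (n → n → ℂ))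
  haveI : SecondCountableTopology (Matrix.specialUnitaryGroup n ℂ) :=
    Topology.IsEmbedding.subtypeVal.secondCountableTopology
  exact (hc m).measurable

/-- Products of a list of continuous real functions are continuous (local helper). [folklore] -/
private theorem continuous_list_prod' {X : Type*} [TopologicalSpace X] {κ : Type*} (f : κ → X → ℝ)
    (hf : ∀ i, Continuous (f i)) : ∀ l : List κ, Continuous fun x => (l.map fun i => f i x).prod
  | [] => by simpa using continuous_const
  | i :: l => by
    show Continuous fun x => f i x * (l.map fun i => f i x).prod
    exact (hf i).mul (continuous_list_prod' f hf l)

/-- **At a continuous no-jump averaging the original string is a CONTINUOUS function of the refined unit field** (the tree's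
`T3ThresholdRemoval.continuous_coarseObs`, abstracted from `expMeanLogSUc`). [cite: Balaban1987RG1, (0.4) p.253] -/
theorem continuous_coarseObs_of
    (h1 : ∀ (m : ℕ) (W : Fin (m + 1) → Matrix.specialUnitaryGroup n ℂ), (¬ ∀ i, dist1 (W i) < ℰ'.δ) → ℰ'.E W = 1)
    (hc : ∀ m : ℕ, Continuous fun W : Fin (m + 1) → Matrix.specialUnitaryGroup n ℂ => ℰ'.E W)
    (F : T3Family) (k : ℕ) (Cs : List (ULoop3 F)) : Continuous (coarseObs F k ℰ' Cs) := by
  have hre : Continuous (reTr : Matrix.specialUnitaryGroup n ℂ → ℝ) :=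
    UnitaryModel.continuous_nReTr.comp (Literature.MathematicalPhysics.QuantumLattice.continuous_fundamentalRep n)
  have hfs : Continuous (fieldShift (G := Matrix.specialUnitaryGroup n ℂ) (sitesPerDir_refine_unit F k)) :=
    continuous_pi fun _ => continuous_apply _
  refine continuous_list_prod' (fun (C : ULoop3 F) (u : GaugeField ((F.refine k).P 0) 0 (Matrix.specialUnitaryGroup n ℂ)) =>
    F.avgObs ℰ' k C (fieldShift (sitesPerDir_refine_unit F k) u)) (fun C => ?_) Cs
  exact (hre.comp (BlockAveraging.continuous_holAt (C.1.atLevel k))).comp ((continuous_iter_blockAvg_of ℰ' h1 hc k).comp hfs)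

end NoJump

end Summit.QuantumFields.YangMills.Theorems.GuardedTransfer

end
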